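import Mathlib
import HarnessLib.Audit
import Summits.PneNP.PneNP.Theorems.PstarLitNorCore

/-!
# The PIN + GATE core accounting lemma (ROUND-24, GAPTWO-PLAN v1.1 S4c′; planner seat p3 g20)

FRONTIER range-avoidance ladder, rung F-N3, ROUND 24 (cell `pnp-ideate`; restricted-model proof complexity — nothing here bears on
`P` versus `NP`).

Memo `CORE-BOUND-NOTES.md` §10.1.  Besides the gadget-NOR mechanism of `PstarLitNorCore` (the second constraint is `NOR(σ,τ)` through a read
pendant `(σ,τ)`), the kit found exactly one other way an XOR-closed core `J₀` of a minimal infeasible `#W = 2` sub-instance gets its chords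
forced: the second constraint is the single PIN `a_σ = 0`, and a chord `e` has a private AND variable `p_e` that the first constraint reads
both linearly and through a READER pendant `(p_e, τ_e)`, so that the read coefficient is `1 + a_{τ_e}` — the chord is read, hence forced,
exactly on the zero-literal flat `{a_σ = a_{τ_e} = 0}`, whose second literal `τ_e` is supplied by the read gate and may differ from chord to
chord.  The forced path of `e` then consists of `σ`-edges and `τ_e`-edges.  Unit: triangle `(σ,b)(τ_e,b′) + e = (p_e,p_e′)` + reader
`(p_e, τ_e)`.  Kit census (local K12 engine, exhaustive `(y,b)` scan, 2026-08-28): one unit — `#J₀ = 3`, minimal infeasible, hereditary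
expansion slack `0` (admissible, and it has NO `(σ,τ)` gadget, so it is not a `LitNorStructure`); `k ≥ 2` units — cores `6, 9` (disjoint) /
`5, 7` (on a common `σ`-edge), all minimal infeasible and all expansion-DEAD (slack `−4, −6 / −2, −3`).  As for the gadget mechanism, only
`3/2`-boundary expansion stops the family, through the accounting inequality (memo §10.2)
`#{AND slots of J₀ holding a multiply-used variable} ≤ (#J₀ + #readers)/2`.

This file TYPES the corresponding combinatorial target:

* `GateReader I J₀ e g l`      : `g ∉ J₀` is a pendant whose AND pair joins the literal `l` to an AND variable of `e`;
* `LitGateStructure I J₀ N σ Λ ρ` : `N ⊆ J₀` are the certified chords; each `e ∈ N` is a chord of `J₀` (`IsChord`), carries neither `σ` nor its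
  gate literal `Λ e ≠ σ`, has a gate reader `ρ e` on `Λ e`, its gate literal is not an AND variable of a certified chord, and its XOR pair is
  joined by a path of edges of `J₀` carrying `σ` or `Λ e` (`LitAdj` of `PstarLitNorCore` with the pair `(σ, Λ e)`); every other output of `J₀`
  carries `σ` or the gate literal of some certified chord;
* `LitGateCoreBound`            : on a pure `P⋆` instance with simple overlaps that is `(r, 3/2)`-boundary expanding, such an XOR-closed `J₀` with
  `#(J₀ ∪ ρ(N)) ≤ r` has `#J₀ ≤ 5` (the census says `3`; `5` is stated to leave room for the mixed designs of memo O5, all of which are dead so far).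

Proof idea (memo §10.2): `σ`-edges are pairwise XOR-disjoint (simple overlaps), and so are the `l`-edges for each literal `l`; every certified chord
spends its private `p_e` twice (chord + reader) and its gate literal at least twice (path edge + reader); the accounting inequality then leaves room
for one unit only.  OPEN FOR CLAIM (pure expansion combinatorics, [M]).
-/

set_option linter.dupNamespace false

open Finset Literature.Computability.Complexity
open Summit.PneNP.PneNP.Theorems.PstarSALevel (varSet bdry BoundaryExpanding SimpleOverlap)
open Summit.PneNP.PneNP.Theorems.PstarChordRepair (IsChord)
open Summit.PneNP.PneNP.Theorems.PstarCoreBound (XorClosed)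
open Summit.PneNP.PneNP.Theorems.PstarLitNorCore (LitEdge LitAdj)

namespace Summit.PneNP.PneNP.Theorems.PstarLitGateCore

variable {n m : ℕ}

/-- `g ∉ J₀` is a GATE READER for the output `e` on the literal `l`: the AND pair of `g` consists of `l` and an AND variable of `e`. -/
def GateReader (I : LocalMap 4 n m) (J₀ : Finset (Fin m)) (e g : Fin m) (l : Fin n) : Prop :=
  g ∉ J₀ ∧ ((I.vars g 2 = l ∧ (I.vars g 3 = I.vars e 2 ∨ I.vars g 3 = I.vars e 3)) ∨
            (I.vars g 3 = l ∧ (I.vars g 2 = I.vars e 2 ∨ I.vars g 2 = I.vars e 3)))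

/-- **PIN + GATE structure** of `J₀` with pin literal `σ`, certified chords `N`, gate literals `Λ` and gate readers `ρ` (see the module
docstring). -/
def LitGateStructure (I : LocalMap 4 n m) (J₀ N : Finset (Fin m)) (σ : Fin n) (Λ : Fin m → Fin n) (ρ : Fin m → Fin m) : Prop :=
  N ⊆ J₀ ∧
  (∀ e ∈ N, Λ e ≠ σ ∧ IsChord I J₀ e ∧ ¬ LitEdge I σ (Λ e) e ∧ GateReader I J₀ e (ρ e) (Λ e) ∧
      (∀ e' ∈ N, Λ e ≠ I.vars e' 2 ∧ Λ e ≠ I.vars e' 3) ∧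
      Relation.ReflTransGen (LitAdj I J₀ σ (Λ e)) (I.vars e 0) (I.vars e 1)) ∧
  (∀ f ∈ J₀ \ N, (I.vars f 2 = σ ∨ I.vars f 3 = σ) ∨ ∃ e ∈ N, I.vars f 2 = Λ e ∨ I.vars f 3 = Λ e)

/-- **GAPTWO-PLAN v1.1 S4c′ — the pin + gate core accounting lemma (OPEN; memo §10.1–10.2).**  FRONTIER. -/
@[conjecture] def LitGateCoreBound : Prop :=
  ∀ (n m r : ℕ) (I : LocalMap 4 n m), I.IsPure xorAndPred → BoundaryExpanding r I → SimpleOverlap I →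
    ∀ (J₀ N : Finset (Fin m)) (σ : Fin n) (Λ : Fin m → Fin n) (ρ : Fin m → Fin m),
      (J₀ ∪ N.image ρ).card ≤ r → XorClosed I J₀ → LitGateStructure I J₀ N σ Λ ρ → J₀.card ≤ 5

/-- Sanity: the empty core carries the structure with no certified chords. -/
theorem litGateStructure_empty (I : LocalMap 4 n m) (σ : Fin n) (Λ : Fin m → Fin n) (ρ : Fin m → Fin m) :
    LitGateStructure I ∅ ∅ σ Λ ρ := by
  refine ⟨Finset.Subset.refl _, ?_, ?_⟩
  · intro e he; simp at he
  · intro f hf; simp at hf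

/-- Sanity: without certified chords every output of `J₀` is a `σ`-edge. -/
theorem sigma_edge_of_litGateStructure_empty (I : LocalMap 4 n m) (J₀ : Finset (Fin m)) (σ : Fin n) (Λ : Fin m → Fin n)
    (ρ : Fin m → Fin m) (h : LitGateStructure I J₀ ∅ σ Λ ρ) :
    ∀ f ∈ J₀, I.vars f 2 = σ ∨ I.vars f 3 = σ := by
  intro f hf
  rcases h with ⟨-, -, h3⟩
  rcases h3 f (by simpa using hf) with h | ⟨e, he, -⟩
  · exact h
  · simp at he

end Summit.PneNP.PneNP.Theorems.PstarLitGateCore
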